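import Mathlib
import Summits.MatrixMultiplication.MatrixMultiplication.Theorems.SubgroupIdentityDesigns.Negative.PackingBridge
import Summits.MatrixMultiplication.MatrixMultiplication.Theorems.SubgroupIdentityDesigns.Negative.LevelOneExact
import Summits.MatrixMultiplication.MatrixMultiplication.Theorems.SubgroupIdentityDesigns.Negative.LevelOneDim

/-!
# The level-one squeeze with the exact dimension: no level-one witness as `ε → 0`, every cell
(support lemma for the crux `SubgroupIdentityDesigns`, stmt-MatrixMultiplication-14079; cell B2b-5
`b2b-lgcu-borel`, gen 11 — report `run/shared/lean/b2b/levelgraded-cu/ORACLE-g11.md` §G11-3f)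

With `s = 2 + ε`, `P = p^{1+l}`, `a = (P − p)/(p − 1)`, `b = (P − 1)/(p − 1)` a level-one witness of
the crux in `GL_{1+l}(𝔽_p)` (`l ≥ 1`) is squeezed between the exact FLOOR
`1 + a^s + (p − 2) b^s ≤ budget < V^{s/3}` (`LevelOneExact.budget_ge_exact`) and the wall CEILING
`2V² ≤ (dim F_1|_G)³` (`PackingBridge.crux_walls`) with the exact dimension
`dim F_1|_G ≤ 1 + a² + (p − 2) b²` (`LevelOneDim.finrank_levelOne_le_real`).  Hence
(`levelOne_dim_master`) `(1 + a^s + (p−2) b^s) · 2^{s/6} < (1 + a² + (p−2) b²)^{s/2}` — an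
inequality that FAILS at `s = 2` in every cell by the factor `2^{1/3}`, and by the power-mean
inequality fails whenever `p^{ε/2} ≤ 2^{(2+ε)/6}` (`no_levelOne_witness_small_eps`): there is NO
level-one witness of the crux in ANY `GL_m(𝔽_p)`, `m ≥ 2`, ANY prime `p`, for all
`0 < ε ≤ ε₃(p) = 2 log 2 / (3 log p − log 2)` (`ε₃(2) = 1`, `ε₃(3) ≈ 0.53`, `ε₃(5) ≈ 0.33`,
`ε₃(7) ≈ 0.26`, `ε₃(13) ≈ 0.19`, `ε₃(101) ≈ 0.10`); the cell-wise thresholds of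
`no_levelOne_witness_dim` are larger (`(p,m) = (2,2), (2,3)`: every `ε < 2`; `(3,2): 0.91`;
`(3,3): 0.99`; `(5,2): 0.39`; `(7,2): 0.29`).  This closes the residue cells
`{(2,2),(3,2),(4,2),(2,3)}` of `LevelOneExact` and supersedes the prime-by-prime windows of
`WitnessWindow` / `LevelOneDegree` for small `ε`; for fixed `ε` and `p → ∞` the window stays open
(floor/ceiling ratio `≍ p^{1 − s/2}`), as it must for any walls-plus-pricing argument.
Sorry-free.  VALUE = uniform no-go theorem for the level-one slice, NOT summit progress; the crux
item (levels `k ≥ 2`, and level one at `ε > ε₃(p)`) stays open.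
-/

set_option linter.dupNamespace false

noncomputable section

open scoped BigOperators Classical Matrix
open Module (finrank)

namespace Summit.MatrixMultiplication.MatrixMultiplication.Theorems.SubgroupIdentityDesigns.Negative
namespace LevelOneDimSqueeze

open Literature.Barriers.MatrixMultiplication (SubgroupTPP)
open Summit.MatrixMultiplication.MatrixMultiplication.Theorems.LieRankDesigns.Negative
  (GLm Mat budget)
open Summit.MatrixMultiplication.MatrixMultiplication.Theorems.LevelOneGL2Designs.Negative
  (levelSubmodule)
open PackingBridge (crux_walls)
open LevelOneExact (budget_ge_exact)
open LevelOneDim (finrank_levelOne_le_real)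

variable {p : ℕ} [hp : Fact p.Prime] {l : ℕ}

/-- **THE MASTER LEVEL-ONE SQUEEZE WITH THE EXACT DIMENSION.**  A level-one witness of the crux at
`ε` in `GL_{1+l}(𝔽_p)`, `l ≥ 1`, forces, with `s = 2 + ε`:
`(1 + a^s + (p−2) b^s) · 2^{s/6} < (1 + a² + (p−2) b²)^{s/2}`. -/
theorem levelOne_dim_master (hl : 1 ≤ l) {ε : ℝ} (hε : 0 < ε)
    {H₁ H₂ H₃ : Subgroup (GLm p (1 + l))} (htpp : SubgroupTPP H₁ H₂ H₃)
    (hdes : ∃ c : Mat p (1 + l) → ℂ, (∀ M, 1 < M.rank → c M = 0) ∧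
      (∑ M, c M * ZMod.stdAddChar (Matrix.trace (M * ((1 : GLm p (1 + l)) : Mat p (1 + l))))) = 1 ∧
      ∀ a ∈ H₁, ∀ b ∈ H₂, ∀ g ∈ H₃, a * b * g ≠ 1 →
        (∑ M, c M * ZMod.stdAddChar
          (Matrix.trace (M * ((a * b * g : GLm p (1 + l)) : Mat p (1 + l))))) = 0)
    (hlt : budget p (1 + l) 1 (2 + ε) <
      ((Nat.card H₁ * Nat.card H₂ * Nat.card H₃ : ℕ) : ℝ) ^ ((2 + ε) / 3)) :
    (1 + (((p : ℝ) ^ (1 + l) - p) / ((p : ℝ) - 1)) ^ (2 + ε) +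
        ((p : ℝ) - 2) * (((p : ℝ) ^ (1 + l) - 1) / ((p : ℝ) - 1)) ^ (2 + ε)) *
      (2 : ℝ) ^ ((2 + ε) / 6) <
      (1 + (((p : ℝ) ^ (1 + l) - p) / ((p : ℝ) - 1)) ^ 2 +
        ((p : ℝ) - 2) * (((p : ℝ) ^ (1 + l) - 1) / ((p : ℝ) - 1)) ^ 2) ^ ((2 + ε) / 2) := by
  have hwalls := crux_walls hε htpp hdes hlt
  have hD := finrank_levelOne_le_real (p := p) (m := 1 + l) (by omega)
  set s : ℝ := 2 + ε with hs_def
  have hs : 0 < s := by rw [hs_def]; linarith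
  set V : ℕ := Nat.card H₁ * Nat.card H₂ * Nat.card H₃ with hV_def
  set D : ℕ := finrank ℂ (levelSubmodule p (1 + l) 1) with hD_def
  have hp2 : 2 ≤ p := hp.out.two_le
  have hpR : (2 : ℝ) ≤ p := by exact_mod_cast hp2
  have hp1 : (0 : ℝ) < (p : ℝ) - 1 := by linarith
  have hPp : (p : ℝ) ≤ (p : ℝ) ^ (1 + l) := by
    calc (p : ℝ) = (p : ℝ) ^ 1 := (pow_one _).symm
      _ ≤ (p : ℝ) ^ (1 + l) := pow_le_pow_right₀ (by linarith) (by omega)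
  have ha0 : 0 ≤ ((p : ℝ) ^ (1 + l) - p) / ((p : ℝ) - 1) := div_nonneg (by linarith) hp1.le
  have hb0 : 0 ≤ ((p : ℝ) ^ (1 + l) - 1) / ((p : ℝ) - 1) := div_nonneg (by linarith) hp1.le
  set Fl : ℝ := 1 + (((p : ℝ) ^ (1 + l) - p) / ((p : ℝ) - 1)) ^ s +
      ((p : ℝ) - 2) * (((p : ℝ) ^ (1 + l) - 1) / ((p : ℝ) - 1)) ^ s with hFl_def
  set D₂ : ℝ := 1 + (((p : ℝ) ^ (1 + l) - p) / ((p : ℝ) - 1)) ^ 2 +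
      ((p : ℝ) - 2) * (((p : ℝ) ^ (1 + l) - 1) / ((p : ℝ) - 1)) ^ 2 with hD₂_def
  -- floor
  have hfl : Fl < (V : ℝ) ^ (s / 3) := (budget_ge_exact (p := p) hl s).trans_lt hlt
  -- ceiling `2 V² ≤ D³ ≤ D₂³`
  have hceR : 2 * (V : ℝ) ^ 2 ≤ (D : ℝ) ^ 3 := by exact_mod_cast hwalls
  have hV0 : (0 : ℝ) ≤ (V : ℝ) := Nat.cast_nonneg _
  have hD0 : (0 : ℝ) ≤ (D : ℝ) := Nat.cast_nonneg _
  have hVsq : (V : ℝ) ^ 2 ≤ (D : ℝ) ^ 3 / 2 := by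
    rw [le_div_iff₀ (by norm_num)]
    linarith
  have hVs : (V : ℝ) ^ (s / 3) = ((V : ℝ) ^ 2) ^ (s / 6) := by
    rw [← Real.rpow_natCast (V : ℝ) 2, ← Real.rpow_mul hV0]
    congr 1; push_cast; ring
  have hup : ((V : ℝ) ^ 2) ^ (s / 6) ≤ ((D : ℝ) ^ 3 / 2) ^ (s / 6) :=
    Real.rpow_le_rpow (by positivity) hVsq (by positivity)
  have hrhs : ((D : ℝ) ^ 3 / 2) ^ (s / 6) = (D : ℝ) ^ (s / 2) / (2 : ℝ) ^ (s / 6) := by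
    rw [Real.div_rpow (by positivity) (by norm_num)]
    have e3 : ((D : ℝ) ^ 3) ^ (s / 6) = (D : ℝ) ^ (s / 2) := by
      rw [← Real.rpow_natCast (D : ℝ) 3, ← Real.rpow_mul hD0]
      congr 1; push_cast; ring
    rw [e3]
  have hDs : (D : ℝ) ^ (s / 2) ≤ D₂ ^ (s / 2) := Real.rpow_le_rpow hD0 hD (by positivity)
  rw [hVs] at hfl
  rw [hrhs] at hup
  have hlt2 := hfl.trans_le hup
  have hden : 0 < (2 : ℝ) ^ (s / 6) := by positivity
  rw [lt_div_iff₀ hden] at hlt2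
  exact hlt2.trans_le hDs

/-- **NO LEVEL-ONE WITNESS UNDER THE EXACT-DIMENSION INEQUALITY** (contrapositive of
`levelOne_dim_master`): if `(1 + a² + (p−2) b²)^{(2+ε)/2} ≤ (1 + a^{2+ε} + (p−2) b^{2+ε}) · 2^{(2+ε)/6}`
then no subgroup triple of `GL_{1+l}(𝔽_p)` carrying a level-one identity design satisfies the crux
inequality at `ε`.  Holds at every `(p, 1+l)` for all small `ε > 0` (largest admissible `ε`, floats:
`(2,2), (2,3)`: all `ε < 2`; `(3,2): 0.91`; `(3,3): 0.99`; `(3,4): 0.99`; `(5,2): 0.39`;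
`(5,3): 0.40`; `(7,2): 0.29`; `(11,2): 0.22`). -/
theorem no_levelOne_witness_dim (hl : 1 ≤ l) {ε : ℝ} (hε : 0 < ε)
    (hthr : (1 + (((p : ℝ) ^ (1 + l) - p) / ((p : ℝ) - 1)) ^ 2 +
        ((p : ℝ) - 2) * (((p : ℝ) ^ (1 + l) - 1) / ((p : ℝ) - 1)) ^ 2) ^ ((2 + ε) / 2) ≤
      (1 + (((p : ℝ) ^ (1 + l) - p) / ((p : ℝ) - 1)) ^ (2 + ε) +
          ((p : ℝ) - 2) * (((p : ℝ) ^ (1 + l) - 1) / ((p : ℝ) - 1)) ^ (2 + ε)) *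
        (2 : ℝ) ^ ((2 + ε) / 6))
    {H₁ H₂ H₃ : Subgroup (GLm p (1 + l))} (htpp : SubgroupTPP H₁ H₂ H₃)
    (hdes : ∃ c : Mat p (1 + l) → ℂ, (∀ M, 1 < M.rank → c M = 0) ∧
      (∑ M, c M * ZMod.stdAddChar (Matrix.trace (M * ((1 : GLm p (1 + l)) : Mat p (1 + l))))) = 1 ∧
      ∀ a ∈ H₁, ∀ b ∈ H₂, ∀ g ∈ H₃, a * b * g ≠ 1 →
        (∑ M, c M * ZMod.stdAddChar
          (Matrix.trace (M * ((a * b * g : GLm p (1 + l)) : Mat p (1 + l))))) = 0) :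
    ¬ budget p (1 + l) 1 (2 + ε) <
      ((Nat.card H₁ * Nat.card H₂ * Nat.card H₃ : ℕ) : ℝ) ^ ((2 + ε) / 3) :=
  fun hlt => absurd (levelOne_dim_master hl hε htpp hdes hlt) (not_lt.mpr hthr)

/-- Power-mean step: for `a, b ≥ 0`, `p ≥ 2`, `q ≥ 1`,
`(1 + a² + (p−2) b²)^q ≤ p^{q−1} · (1 + (a²)^q + (p−2) (b²)^q)`. -/
theorem pow_mean_three {P₀ A B q : ℝ} (hP : 2 ≤ P₀) (hA : 0 ≤ A) (hB : 0 ≤ B) (hq : 1 ≤ q) :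
    (1 + A + (P₀ - 2) * B) ^ q ≤ P₀ ^ (q - 1) * (1 + A ^ q + (P₀ - 2) * B ^ q) := by
  have hP0 : 0 < P₀ := by linarith
  have hw : ∀ i ∈ (Finset.univ : Finset (Fin 3)), 0 ≤ ![1 / P₀, 1 / P₀, (P₀ - 2) / P₀] i := by
    intro i _
    fin_cases i
    · simp; positivity
    · simp; positivity
    · simp; exact div_nonneg (by linarith) hP0.le
  have hw' : ∑ i ∈ (Finset.univ : Finset (Fin 3)), ![1 / P₀, 1 / P₀, (P₀ - 2) / P₀] i = 1 := by
    simp [Fin.sum_univ_three]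
    field_simp
    ring
  have hz : ∀ i ∈ (Finset.univ : Finset (Fin 3)), 0 ≤ ![(1 : ℝ), A, B] i := by
    intro i _
    fin_cases i
    · simp
    · simpa using hA
    · simpa using hB
  have hpm := Real.rpow_arith_mean_le_arith_mean_rpow (s := (Finset.univ : Finset (Fin 3)))
    ![1 / P₀, 1 / P₀, (P₀ - 2) / P₀] ![(1 : ℝ), A, B] hw hw' hz hq
  simp only [Fin.sum_univ_three, Matrix.cons_val_zero, Matrix.cons_val_one, Matrix.head_cons,
    Matrix.cons_val_two, Matrix.tail_cons, Real.one_rpow, mul_one] at hpm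
  -- `hpm : (1/P₀ + 1/P₀ * A + (P₀-2)/P₀ * B)^q ≤ 1/P₀ + 1/P₀ * A^q + (P₀-2)/P₀ * B^q`
  have hM : 1 / P₀ + 1 / P₀ * A + (P₀ - 2) / P₀ * B = (1 + A + (P₀ - 2) * B) / P₀ := by
    field_simp
  have hR : 1 / P₀ + 1 / P₀ * A ^ q + (P₀ - 2) / P₀ * B ^ q = (1 + A ^ q + (P₀ - 2) * B ^ q) / P₀ := by
    field_simp
  have hX0 : 0 ≤ 1 + A + (P₀ - 2) * B := by
    have := mul_nonneg (sub_nonneg.mpr hP) hB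
    linarith
  rw [hM, hR, Real.div_rpow hX0 hP0.le, div_le_iff₀ (Real.rpow_pos_of_pos hP0 q)] at hpm
  rw [Real.rpow_sub_one hP0.ne' q]
  calc (1 + A + (P₀ - 2) * B) ^ q ≤ (1 + A ^ q + (P₀ - 2) * B ^ q) / P₀ * P₀ ^ q := hpm
    _ = P₀ ^ q / P₀ * (1 + A ^ q + (P₀ - 2) * B ^ q) := by ring

/-- **NO LEVEL-ONE WITNESS FOR SMALL `ε`, EVERY CELL.**  If `p^{ε/2} ≤ 2^{(2+ε)/6}` — i.e.
`0 < ε ≤ ε₃(p) = 2 log 2/(3 log p − log 2)` (`ε₃(2) = 1`, `ε₃(3) ≈ 0.53`, `ε₃(5) ≈ 0.33`,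
`ε₃(7) ≈ 0.26`, `ε₃(11) ≈ 0.20`, `ε₃(101) ≈ 0.10`, `ε₃(1009) ≈ 0.069`) — then NO subgroup triple of
ANY `GL_{1+l}(𝔽_p)`, `l ≥ 1`, carrying a level-one identity design satisfies the crux inequality at
`ε` (power mean: `(1 + a² + (p−2)b²)^{s/2} ≤ p^{ε/2} (1 + a^s + (p−2) b^s)`). -/
theorem no_levelOne_witness_small_eps (hl : 1 ≤ l) {ε : ℝ} (hε : 0 < ε)
    (hthr : (p : ℝ) ^ (ε / 2) ≤ (2 : ℝ) ^ ((2 + ε) / 6))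
    {H₁ H₂ H₃ : Subgroup (GLm p (1 + l))} (htpp : SubgroupTPP H₁ H₂ H₃)
    (hdes : ∃ c : Mat p (1 + l) → ℂ, (∀ M, 1 < M.rank → c M = 0) ∧
      (∑ M, c M * ZMod.stdAddChar (Matrix.trace (M * ((1 : GLm p (1 + l)) : Mat p (1 + l))))) = 1 ∧
      ∀ a ∈ H₁, ∀ b ∈ H₂, ∀ g ∈ H₃, a * b * g ≠ 1 →
        (∑ M, c M * ZMod.stdAddChar
          (Matrix.trace (M * ((a * b * g : GLm p (1 + l)) : Mat p (1 + l))))) = 0) :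
    ¬ budget p (1 + l) 1 (2 + ε) <
      ((Nat.card H₁ * Nat.card H₂ * Nat.card H₃ : ℕ) : ℝ) ^ ((2 + ε) / 3) := by
  refine no_levelOne_witness_dim hl hε ?_ htpp hdes
  have hp2 : 2 ≤ p := hp.out.two_le
  have hpR : (2 : ℝ) ≤ p := by exact_mod_cast hp2
  have hp0 : (0 : ℝ) < p := by linarith
  have hp1 : (0 : ℝ) < (p : ℝ) - 1 := by linarith
  have hPp : (p : ℝ) ≤ (p : ℝ) ^ (1 + l) := by
    calc (p : ℝ) = (p : ℝ) ^ 1 := (pow_one _).symm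
      _ ≤ (p : ℝ) ^ (1 + l) := pow_le_pow_right₀ (by linarith) (by omega)
  set a : ℝ := ((p : ℝ) ^ (1 + l) - p) / ((p : ℝ) - 1) with ha_def
  set b : ℝ := ((p : ℝ) ^ (1 + l) - 1) / ((p : ℝ) - 1) with hb_def
  have ha0 : 0 ≤ a := div_nonneg (by linarith) hp1.le
  have hb0 : 0 ≤ b := div_nonneg (by linarith) hp1.le
  set s : ℝ := 2 + ε with hs_def
  have hq : 1 ≤ s / 2 := by rw [hs_def]; linarith
  have hpm := pow_mean_three (P₀ := (p : ℝ)) (A := a ^ 2) (B := b ^ 2) hpR (by positivity)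
    (by positivity) hq
  have ea : (a ^ 2) ^ (s / 2) = a ^ s := by
    rw [← Real.rpow_natCast a 2, ← Real.rpow_mul ha0]
    congr 1; push_cast; ring
  have eb : (b ^ 2) ^ (s / 2) = b ^ s := by
    rw [← Real.rpow_natCast b 2, ← Real.rpow_mul hb0]
    congr 1; push_cast; ring
  have es : s / 2 - 1 = ε / 2 := by rw [hs_def]; ring
  rw [ea, eb, es] at hpm
  have hFl0 : 0 ≤ 1 + a ^ s + ((p : ℝ) - 2) * b ^ s := by
    have h1 : 0 ≤ a ^ s := Real.rpow_nonneg ha0 s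
    have h2 : 0 ≤ ((p : ℝ) - 2) * b ^ s := mul_nonneg (by linarith) (Real.rpow_nonneg hb0 s)
    linarith
  calc (1 + a ^ 2 + ((p : ℝ) - 2) * b ^ 2) ^ (s / 2)
      ≤ (p : ℝ) ^ (ε / 2) * (1 + a ^ s + ((p : ℝ) - 2) * b ^ s) := hpm
    _ ≤ (2 : ℝ) ^ (s / 6) * (1 + a ^ s + ((p : ℝ) - 2) * b ^ s) :=
        mul_le_mul_of_nonneg_right hthr hFl0
    _ = (1 + a ^ s + ((p : ℝ) - 2) * b ^ s) * (2 : ℝ) ^ (s / 6) := mul_comm _ _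

end LevelOneDimSqueeze
end Summit.MatrixMultiplication.MatrixMultiplication.Theorems.SubgroupIdentityDesigns.Negative
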